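import Summits.AtomisticToContinuum.BoseEinsteinCondensation.Theorems.StaticResponseBound.Negative.Basic
import Literature.MathematicalPhysics.QuantumManyBody.PeriodicFormDomain
import Literature.MathematicalPhysics.QuantumManyBody.PeriodicBoseGasMomentumSector
import HarnessLib

/-!
# `stub_maxFormBound` needs `0 < L`: at `L = 0` the trial class is empty but the maximal form is not

Negative lemma (load-bearing analysis) for the stub `stub_maxFormBound` (MaxFormBound, skeleton v3 of line
`uv-thomson-force-wave`, crux `BECInsertionCorrector.StaticResponseBound`, item stmt-AtomisticToContinuum-12057),
drefute gen-3.

MaxFormBound bounds the `C¹`-core ground-state energy `periodicGroundStateEnergy v N L` by the maximal-form energy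
of any unit, Bose-symmetric `η ∈ L²((ℝ/ℤ)^{3N})`. Its hypothesis `0 < L` cannot be dropped: for `L = 0` and
`N = 1` the cell `[0,0)³` is empty, so there is no periodic trial state and the left-hand side is `⨅ ∅ = ⊤`,
while for `v = 0` and `η = e₀ = 1` the right-hand side is `0` — the spectral weights `(2πn/L)²` are `0` by
`x / 0 = 0` and there is no pair interaction (`not_maxFormBound_without_pos_L`). So any proof of MaxFormBound
must use `hL` (it enters through the non-emptiness of `PeriodicTrialState N L` and the scaling to the unit
torus). [folklore]
-/

noncomputable section

namespace Summit.AtomisticToContinuum.BoseEinsteinCondensation.Theorems.StaticResponseBound.Negative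

open MeasureTheory UnitAddTorus
open scoped ENNReal NNReal BigOperators InnerProductSpace
open Literature.MathematicalPhysics.QuantumManyBody.BoseGas

-- The measure on `ℝ/ℤ` is the Haar PROBABILITY measure, exactly as in the registered stub text.
attribute [local instance] Literature.MathematicalPhysics.QuantumManyBody.BoseGas.formDomain_measureSpace
  Literature.MathematicalPhysics.QuantumManyBody.BoseGas.formDomain_isProbabilityMeasure
  Literature.MathematicalPhysics.QuantumManyBody.BoseGas.formDomain_isProbabilityMeasure_pi

/-- With no trial states (`L ≤ 0 < N`) the `C¹`-core ground-state energy is `⊤`. [folklore] -/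
theorem periodicGroundStateEnergy_of_nonpos {L : ℝ} (hL : L ≤ 0) {N : ℕ} (hN : 0 < N) (v : ℝ → ℝ≥0∞) :
    periodicGroundStateEnergy v N L = ⊤ := by
  haveI := PeriodicTrialState.isEmpty_of_nonpos hL hN
  exact iInf_of_empty _

/-- For the zero potential the periodic interaction vanishes identically. [folklore] -/
theorem periodicInteraction_zero_potential {N : ℕ} (L : ℝ) (X : Config N) :
    periodicInteraction (0 : ℝ → ℝ≥0∞) L X = 0 := by
  simp [periodicInteraction, periodizedPotential]

/-- **MaxFormBound without `0 < L` is false.** Deleting the hypothesis `0 < L` from the registered stub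
`stub_maxFormBound` gives a false statement: witness `v = 0`, `N = 1`, `L = 0`, `η = e₀`. [folklore] -/
theorem not_maxFormBound_without_pos_L :
    ¬ (∀ v : ℝ → ℝ≥0∞, IsRepulsiveFiniteRange v → ∀ (N : ℕ) (L : ℝ),
        ∀ η : Lp ℂ 2 (volume : Measure (UnitAddTorus (Fin N × Fin 3))), ‖η‖ = 1 →
          (∀ (σ : Equiv.Perm (Fin N)) (n : Fin N × Fin 3 → ℤ),
            ⟪(mFourierLp 2 (fun p : Fin N × Fin 3 => n (σ p.1, p.2)) :
                Lp ℂ 2 (volume : Measure (UnitAddTorus (Fin N × Fin 3)))), η⟫_ℂ =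
              ⟪(mFourierLp 2 n : Lp ℂ 2 (volume : Measure (UnitAddTorus (Fin N × Fin 3)))), η⟫_ℂ) →
          periodicGroundStateEnergy v N L ≤
            ∑' n : Fin N × Fin 3 → ℤ, ENNReal.ofReal (∑ p, (2 * Real.pi * (n p : ℝ) / L) ^ 2) *
                (‖⟪(mFourierLp 2 n : Lp ℂ 2 (volume : Measure (UnitAddTorus (Fin N × Fin 3)))), η⟫_ℂ‖₊ :
                  ℝ≥0∞) ^ 2 +
              ∫⁻ t, periodicInteraction v L (fromUnitTorusN L t) *
                (‖(η : UnitAddTorus (Fin N × Fin 3) → ℂ) t‖₊ : ℝ≥0∞) ^ 2) := by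
  intro h
  have hnorm : ‖(mFourierLp 2 (0 : Fin 1 × Fin 3 → ℤ) :
      Lp ℂ 2 (volume : Measure (UnitAddTorus (Fin 1 × Fin 3))))‖ = 1 :=
    orthonormal_mFourier.norm_eq_one 0
  have hsymm : ∀ (σ : Equiv.Perm (Fin 1)) (n : Fin 1 × Fin 3 → ℤ),
      ⟪(mFourierLp 2 (fun p : Fin 1 × Fin 3 => n (σ p.1, p.2)) :
          Lp ℂ 2 (volume : Measure (UnitAddTorus (Fin 1 × Fin 3)))), mFourierLp 2 0⟫_ℂ =
        ⟪(mFourierLp 2 n : Lp ℂ 2 (volume : Measure (UnitAddTorus (Fin 1 × Fin 3)))),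
          mFourierLp 2 0⟫_ℂ := by
    intro σ n
    have hn : (fun p : Fin 1 × Fin 3 => n (σ p.1, p.2)) = n :=
      funext fun p => by rw [Subsingleton.elim (σ p.1) p.1]
    rw [hn]
  have h1 := h 0 isRepulsiveFiniteRange_zero 1 0 (mFourierLp 2 0) hnorm hsymm
  rw [periodicGroundStateEnergy_of_nonpos le_rfl one_pos] at h1
  have hkin : (∑' n : Fin 1 × Fin 3 → ℤ, ENNReal.ofReal (∑ p, (2 * Real.pi * (n p : ℝ) / 0) ^ 2) *
      (‖⟪(mFourierLp 2 n : Lp ℂ 2 (volume : Measure (UnitAddTorus (Fin 1 × Fin 3)))),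
        mFourierLp 2 0⟫_ℂ‖₊ : ℝ≥0∞) ^ 2) = 0 := by
    simp
  have hpot : (∫⁻ t, periodicInteraction (0 : ℝ → ℝ≥0∞) 0 (fromUnitTorusN 0 t) *
      (‖((mFourierLp 2 (0 : Fin 1 × Fin 3 → ℤ) :
          Lp ℂ 2 (volume : Measure (UnitAddTorus (Fin 1 × Fin 3)))) :
            UnitAddTorus (Fin 1 × Fin 3) → ℂ) t‖₊ : ℝ≥0∞) ^ 2) = 0 := by
    simp [periodicInteraction_zero_potential]
  rw [hkin, hpot, zero_add] at h1
  exact absurd h1 (by simp)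

end Summit.AtomisticToContinuum.BoseEinsteinCondensation.Theorems.StaticResponseBound.Negative

end
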